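import Mathlib
import HarnessLib
import Literature.MathematicalPhysics.QuantumLattice.GaugeGroups
import Literature.MathematicalPhysics.QuantumFieldTheory.ConstructiveQFTWave0
import Summits.Ventures.LatticeQCDFlow.Scaling.LatticeEntropySUN
import Summits.Ventures.LatticeQCDFlow.Scaling.LatticeEntropySUNBalls
import Summits.Ventures.LatticeQCDFlow.Scaling.SU2CapVolume

/-!
# The `SU(2)` entropy-growth law is UNCONDITIONAL (pub-lqcd THEORY-2 v2.3, package #21d)

HONEST FRAMING: exact (Metropolis-corrected) sampling algorithms for lattice gauge theory;
figures of merit are autocorrelation/cost numbers at stated couplings and volumes;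
no continuum-physics claim.

The two Haar-volume items of #20b are PROVED for `N = 2`:

* `haarActionBallLower_two : SUN.HaarActionBallLower 2` — `Haar{U ∈ SU(2) : 2 - Re tr U ≤ r²}
  ≥ r³ / (32·vol B⁴)` for `0 < r ≤ 1`;
* `haarActionBallUpper_two : SUN.HaarActionBallUpper 2` — `… ≤ 16·r³ / vol B⁴` for `0 < r`;

(`vol B⁴` = Lebesgue volume of the unit ball of `ℝ⁴`), from `Haar_{SU(2)} =` normalised surface
measure of `S³` (#21a/#21b) and the cone-over-cap volume bounds (#21c).  Hence (H1), (H2) and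
the SHARP TWO-SIDED ENTROPY-GROWTH LAW hold for `SU(2)` lattice gauge theory in every dimension
with NO remaining hypothesis: `entropyGrowthLaw_two : SUN.EntropyGrowthLaw d 2`, i.e.
`3((d-1)V(1/2 - 1/L) - 1/2)·log β - CV ≤ D(μ_{Λ,β} ‖ Haar^{⊗E}) ≤ 3((d-1)V + 1)/2·log β + CV`.
-/

noncomputable section

open MeasureTheory Measure Set Metric
open Literature.MathematicalPhysics.QuantumLattice Literature.MathematicalPhysics.QuantumFieldTheory
open scoped Pointwise ENNReal

namespace Summit.Ventures.LatticeQCDFlow.Theory2.Lattice.SU2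

/-- The item's action ball at `N = 2` is the action ball of #21b. -/
theorem actionBall_eq (r : ℝ) :
    {U : G2 | ((2 : ℕ) : ℝ) - (fundamentalRep (Fin 2) U).trace.re ≤ r ^ 2} =
      {U : G2 | 2 - (U : Matrix (Fin 2) (Fin 2) ℂ).trace.re ≤ r ^ 2} := by
  ext U
  simp

/-- Haar probability of the action ball as a real number: `vol(capCone r) / vol(B⁴)`. -/
theorem haar_actionBall_toReal (r : ℝ) :
    ((haarProbability G2)
        {U : G2 | ((2 : ℕ) : ℝ) - (fundamentalRep (Fin 2) U).trace.re ≤ r ^ 2}).toReal =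
      (volume (capCone r)).toReal / (volume (ball (0 : R4) 1)).toReal := by
  rw [actionBall_eq, haarProbability_actionBall, ENNReal.toReal_div]
  rfl

/-- The exponent `N² - 1 = 3` at `N = 2`, as a real power. -/
theorem rpow_three (r : ℝ) : r ^ (((2 : ℕ) : ℝ) ^ 2 - 1) = r ^ 3 := by
  have hexp : ((2 : ℕ) : ℝ) ^ 2 - 1 = ((3 : ℕ) : ℝ) := by norm_num
  rw [hexp, Real.rpow_natCast]

/-- **`SUN.HaarActionBallLower 2` PROVED**: `r³/(32·vol B⁴) ≤ Haar{2 - Re tr U ≤ r²}`,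
`0 < r ≤ 1`. -/
theorem haarActionBallLower_two : SUN.HaarActionBallLower 2 := by
  intro _
  have hb := volume_ball_toReal_pos
  refine ⟨(1 / 32) / (volume (ball (0 : R4) 1)).toReal, div_pos (by norm_num) hb,
    fun r hr hr1 => ?_⟩
  rw [haar_actionBall_toReal, rpow_three]
  have hfin : volume (capCone r) ≠ ∞ :=
    (lt_of_le_of_lt (volume_capCone_le hr.le) ENNReal.ofReal_lt_top).ne
  have hlo : r ^ 3 / 32 ≤ (volume (capCone r)).toReal := by
    have := ENNReal.toReal_mono hfin (le_volume_capCone hr hr1)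
    rwa [ENNReal.toReal_ofReal (by positivity)] at this
  rw [div_mul_eq_mul_div]
  exact div_le_div_of_nonneg_right (by linarith) hb.le

/-- **`SUN.HaarActionBallUpper 2` PROVED**: `Haar{2 - Re tr U ≤ r²} ≤ 16·r³/vol B⁴`, `0 < r`. -/
theorem haarActionBallUpper_two : SUN.HaarActionBallUpper 2 := by
  intro _
  have hb := volume_ball_toReal_pos
  refine ⟨16 / (volume (ball (0 : R4) 1)).toReal, fun r hr => ?_⟩
  rw [haar_actionBall_toReal, rpow_three]
  have hup : (volume (capCone r)).toReal ≤ 16 * r ^ 3 :=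
    ENNReal.toReal_le_of_le_ofReal (by positivity) (volume_capCone_le hr.le)
  rw [div_mul_eq_mul_div]
  exact div_le_div_of_nonneg_right hup hb.le

/-- (H2) for `SU(2)`, unconditional. -/
theorem smallBalls_two : SUN.SmallBalls 2 :=
  SUN.smallBalls_of_haarActionBallLower 2 haarActionBallLower_two

/-- (H1) for `SU(2)`, unconditional: `Z₁(β) ≤ A·β^{-3/2}`. -/
theorem onePlaquetteDecay_two : SUN.OnePlaquetteDecay 2 :=
  SUN.onePlaquetteDecay_of_haarActionBallUpper 2 haarActionBallUpper_two

/-- **THE `SU(2)` ENTROPY-GROWTH LAW, UNCONDITIONAL** (every dimension `d`):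
`3((d-1)V(1/2 - 1/L) - 1/2)·log β - CV ≤ D(μ_{Λ,β} ‖ Haar^{⊗E}) ≤ 3((d-1)V + 1)/2·log β + CV`. -/
theorem entropyGrowthLaw_two (d : ℕ) : SUN.EntropyGrowthLaw d 2 :=
  SUN.entropyGrowthLaw_of_haarActionBalls d 2 haarActionBallLower_two haarActionBallUpper_two

end Summit.Ventures.LatticeQCDFlow.Theory2.Lattice.SU2

end
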